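import Literature.NumberTheory.EllipticCurves.DivisionTowerH1OrderTwoCriterion
import Literature.NumberTheory.EllipticCurves.DivisionTowerH1AnnihilatorOfHomothetyProofs
import Literature.NumberTheory.EllipticCurves.DivisionTowerH1OrderTwoSurjectiveElements
import HarnessLib

/-!
# `#H¹(Gal(L/K), E(L)[2^k]) ≤ 2` for `L ⊆ K(E[2^k])` when `ρ̄_{E,2^k}` is SURJECTIVE — PART 3:
# the diagonal family, `LDU`, and the assembly (Lawson–Wuthrich 2016 at the even prime)

`Proofs`-style file (THEOREMS ONLY).  Discharges the hypotheses of the abstract criterion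
`Rubin1987.eq_zero_or_eq_zero_or_eq_of_mem_subgroupResKer` (`DivisionTowerH1OrderTwoCriterion`) for an
elliptic curve `E/K` over ANY field with `2 ≠ 0` and SURJECTIVE mod-`2^k` representation (`k ≥ 1`), in a
frame `e : E[2^k] ≃ (ℤ/2^k)²` with framed representation `ρ : Γ_K → GL₂(ℤ/2^k)`
(`DivisionTowerH1OrderTwoFrames`): `V = E[2] = {0, E₁, E₂, E₁ + E₂}` with `E₁ = e⁻¹(2^{k-1}, 0)`,
`E₂ = e⁻¹(0, 2^{k-1})`; `z = ρ⁻¹(3)`, the transvections `t = ρ⁻¹(1 1; 0 1)`, `t' = ρ⁻¹(1 0; 1 1)`, the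
swap `s`; the diagonal family = all `σ` with `ρ(σ)` diagonal, normalised by `t, t'` up to powers of
`t², t'²` (`T D = D T^{2m+1}`); and the `LDU` generation of the stabiliser of `V` (the matrices
`≡ 1 mod 2`).  Main theorems:

* `LawsonWuthrich2016.eq_zero_or_eq_zero_or_eq_of_mem_subgroupResKer_two_pow` — any two non-zero
  classes of `ker (H¹(Γ_K, E[2^k]) → H¹(N, E[2^k]))` coincide, for every open normal `N ⊇ Γ_{K(E[2^k])}`;
* `LawsonWuthrich2016.natCard_subgroupResKer_two_pow_le_two` — **`#H¹(Gal(L/K), E(L)[2^k]) ≤ 2`** for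
  every finite Galois `L ⊆ K(E[2^k])` (`N = Gal(K̄/L)`), in particular `#H¹(K(E[2^k])/K, E[2^k]) ≤ 2`.

Together with `DivisionTowerH1AnnihilatorOfHomothetyProofs` (`2 · H¹ = 0`) this is the `p = 2`
replacement of the vanishing `H¹(K(E[p^k])/K, E[p^k]) = 0` (`p` odd, one homothety `≠ 1`) used by the
Kolyvagin-system arguments; consumers: route `GenusKolyvaginAtTwo` (cruxes 22136/22137, the `(H2′)`
repair of LINE 6).  «beyond-print theorem»: no (finite group cohomology of `GL₂(ℤ/2^k)`;
Lawson–Wuthrich 2016 §7.1).  BSD is NOT proved by this file.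

References: T. Lawson, C. Wuthrich, *Vanishing of some Galois cohomology groups for elliptic curves*
(2016), §2, Lemma 3, §7.1 [LawsonWuthrich2016]; C.-H. Sah, J. Algebra 10 (1968), Prop. 2.7 (b) [Sah1968].
-/

set_option autoImplicit false

noncomputable section

open scoped Classical MatrixGroups

open WeierstrassCurve Field Matrix Literature.NumberTheory.GaloisRepresentations

universe u

namespace Literature.NumberTheory.EllipticCurves

namespace LawsonWuthrich2016

section Discharge

variable {K : Type u} [Field K] (W : WeierstrassCurve K) (j : ℕ)
  (e : geomTorsion W ((2 ^ (j + 1) : ℕ) : ℤ) ≃+ (Fin 2 → ZMod (2 ^ (j + 1))))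
  (ρ : absoluteGaloisGroup K →* GL (Fin 2) (ZMod (2 ^ (j + 1))))
  (hρ : ∀ (σ : absoluteGaloisGroup K) (P : geomTorsion W ((2 ^ (j + 1) : ℕ) : ℤ)),
    e (σ • P) = ((ρ σ : GL (Fin 2) (ZMod (2 ^ (j + 1)))) : Matrix (Fin 2) (Fin 2) (ZMod (2 ^ (j + 1)))) *ᵥ e P)


/-! ##### The diagonal family: all `σ` with `ρ(σ)` diagonal -/

omit hρ in
/-- The diagonal entries of an invertible diagonal matrix are units. [folklore] -/
private theorem isUnit_diag (U : GL (Fin 2) (ZMod (2 ^ (j + 1)))) (h01 : (U : Matrix (Fin 2) (Fin 2) (ZMod (2 ^ (j + 1)))) 0 1 = 0)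
    (h10 : (U : Matrix (Fin 2) (Fin 2) (ZMod (2 ^ (j + 1)))) 1 0 = 0) :
    IsUnit ((U : Matrix (Fin 2) (Fin 2) (ZMod (2 ^ (j + 1)))) 0 0) ∧ IsUnit ((U : Matrix (Fin 2) (Fin 2) (ZMod (2 ^ (j + 1)))) 1 1) := by
  have hdet : IsUnit (U : Matrix (Fin 2) (Fin 2) (ZMod (2 ^ (j + 1)))).det :=
    (Matrix.isUnit_iff_isUnit_det _).1 (Units.isUnit U)
  rw [Matrix.det_fin_two, h01, h10, mul_zero, sub_zero] at hdet
  exact IsUnit.mul_iff.1 hdet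

omit hρ in
/-- An invertible diagonal matrix is `diag(U₀₀, U₁₁)`. [folklore] -/
private theorem eq_diag (U : GL (Fin 2) (ZMod (2 ^ (j + 1)))) (h01 : (U : Matrix (Fin 2) (Fin 2) (ZMod (2 ^ (j + 1)))) 0 1 = 0)
    (h10 : (U : Matrix (Fin 2) (Fin 2) (ZMod (2 ^ (j + 1)))) 1 0 = 0) :
    (U : Matrix (Fin 2) (Fin 2) (ZMod (2 ^ (j + 1)))) =
      !![(U : Matrix (Fin 2) (Fin 2) (ZMod (2 ^ (j + 1)))) 0 0, 0; 0, (U : Matrix (Fin 2) (Fin 2) (ZMod (2 ^ (j + 1)))) 1 1] := by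
  conv_lhs => rw [Matrix.eta_fin_two (U : Matrix (Fin 2) (Fin 2) (ZMod (2 ^ (j + 1))))]
  rw [h01, h10]

omit hρ in
/-- A unit of `ℤ/2^{j+1}` fixes `2^j`. [folklore] -/
private theorem unit_mul_half {a : (ZMod (2 ^ (j + 1)))} (ha : IsUnit a) : a * ((2 : ZMod (2 ^ (j + 1))) ^ j) = ((2 : ZMod (2 ^ (j + 1))) ^ j) := by
  obtain ⟨u, rfl⟩ := ha
  obtain ⟨c, hc⟩ := exists_unit_eq_one_add_two_mul j u
  rw [hc, one_add_two_mul_mul_half]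

include hρ in
/-- A `σ` with diagonal `ρ(σ)` fixes `V`. [cite: LawsonWuthrich2016, §2] -/
private theorem mem_fixingSubgroup_of_diag {σ : absoluteGaloisGroup K}
    (h01 : ((ρ σ : GL (Fin 2) (ZMod (2 ^ (j + 1)))) : Matrix (Fin 2) (Fin 2) (ZMod (2 ^ (j + 1)))) 0 1 = 0)
    (h10 : ((ρ σ : GL (Fin 2) (ZMod (2 ^ (j + 1)))) : Matrix (Fin 2) (Fin 2) (ZMod (2 ^ (j + 1)))) 1 0 = 0) :
    σ ∈ fixingSubgroup (absoluteGaloisGroup K)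
      {v : geomTorsion W ((2 ^ (j + 1) : ℕ) : ℤ) | (2 : ℤ) • v = 0} := by
  obtain ⟨hu0, hu1⟩ := isUnit_diag j (ρ σ) h01 h10
  refine Rubin1987.mem_fixingSubgroup_of_smul_eq (mem_V_iff W j e) ?_ ?_
  · rw [smul_symm_of_rep_eq W j e ρ hρ (eq_diag j (ρ σ) h01 h10), mulVec_two, unit_mul_half j hu0]
    congr 1; funext i; fin_cases i <;> simp
  · rw [smul_symm_of_rep_eq W j e ρ hρ (eq_diag j (ρ σ) h01 h10), mulVec_two, unit_mul_half j hu1]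
    congr 1; funext i; fin_cases i <;> simp

include hρ in
/-- **`t σ t⁻¹ ≡ σ (t²)^m (mod Γ_{K(E[2^k])})`** for diagonal `ρ(σ) = diag(x, y)`: `T D = D T^{2m+1}`
with `2 m x = y − x`. [cite: LawsonWuthrich2016, §2] -/
private theorem conj_diag_t {σ t : absoluteGaloisGroup K}
    (ht : ((ρ t : GL (Fin 2) (ZMod (2 ^ (j + 1)))) : Matrix (Fin 2) (Fin 2) (ZMod (2 ^ (j + 1)))) = !![1, 1; 0, 1])
    (h01 : ((ρ σ : GL (Fin 2) (ZMod (2 ^ (j + 1)))) : Matrix (Fin 2) (Fin 2) (ZMod (2 ^ (j + 1)))) 0 1 = 0)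
    (h10 : ((ρ σ : GL (Fin 2) (ZMod (2 ^ (j + 1)))) : Matrix (Fin 2) (Fin 2) (ZMod (2 ^ (j + 1)))) 1 0 = 0) :
    ∃ (m : ℤ), ∃ n ∈ torsionFixing W ((2 ^ (j + 1) : ℕ) : ℤ), t * σ * t⁻¹ = σ * (t * t) ^ m * n := by
  haveI : NeZero (2 ^ (j + 1)) := ⟨pow_ne_zero _ two_ne_zero⟩
  obtain ⟨hu0, hu1⟩ := isUnit_diag j (ρ σ) h01 h10
  obtain ⟨u, hu⟩ := hu0
  obtain ⟨v, hv⟩ := hu1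
  obtain ⟨c, hc⟩ := exists_units_sub_eq_two_mul j u v
  set m : ℕ := (c * ((u⁻¹ : (ZMod (2 ^ (j + 1)))ˣ) : (ZMod (2 ^ (j + 1))))).val with hm
  have hmR : (m : (ZMod (2 ^ (j + 1)))) = c * ((u⁻¹ : (ZMod (2 ^ (j + 1)))ˣ) : (ZMod (2 ^ (j + 1)))) := by rw [hm, ZMod.natCast_zmod_val]
  -- `T · D = D · T^{2m+1}`
  have hy : ((ρ σ : GL (Fin 2) (ZMod (2 ^ (j + 1)))) : Matrix (Fin 2) (Fin 2) (ZMod (2 ^ (j + 1)))) 1 1 =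
      ((ρ σ : GL (Fin 2) (ZMod (2 ^ (j + 1)))) : Matrix (Fin 2) (Fin 2) (ZMod (2 ^ (j + 1)))) 0 0 * (2 * (m : (ZMod (2 ^ (j + 1)))) + 1) := by
    rw [← hu, ← hv, hmR]
    have h1 : (u : (ZMod (2 ^ (j + 1)))) * ((u⁻¹ : (ZMod (2 ^ (j + 1)))ˣ) : (ZMod (2 ^ (j + 1)))) = 1 := Units.mul_inv u
    linear_combination hc - 2 * c * h1
  have key : ρ (t * σ) = ρ (σ * (t * t) ^ m * t) := by
    apply Units.ext
    rw [map_mul, map_mul, map_mul, map_pow, map_mul, Units.val_mul, Units.val_mul, Units.val_mul,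
      Units.val_pow_eq_pow_val, Units.val_mul, ht, eq_diag j (ρ σ) h01 h10,
      transvection_mul_diagonal _ _ (m : (ZMod (2 ^ (j + 1)))) hy, mul_assoc, ← pow_two, ← pow_mul, ← pow_succ,
      transvection_pow]
    congr 2
    push_cast; ring
  have key' : ρ (t * σ * t⁻¹) = ρ (σ * (t * t) ^ m) := by
    rw [map_mul, key, map_mul, map_inv, mul_inv_cancel_right]
  obtain ⟨n, hn, h⟩ := exists_mem_torsionFixing_of_rep_eq W e ρ hρ key'
  exact ⟨m, n, hn, by rw [zpow_natCast]; exact h⟩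

include hρ in
/-- **`t' σ t'⁻¹ ≡ σ (t'²)^m (mod Γ_{K(E[2^k])})`** for diagonal `ρ(σ)`: `T' D = D T'^{2m+1}` with
`2 m y = x − y`. [cite: LawsonWuthrich2016, §2] -/
private theorem conj_diag_t' {σ t' : absoluteGaloisGroup K}
    (ht' : ((ρ t' : GL (Fin 2) (ZMod (2 ^ (j + 1)))) : Matrix (Fin 2) (Fin 2) (ZMod (2 ^ (j + 1)))) = !![1, 0; 1, 1])
    (h01 : ((ρ σ : GL (Fin 2) (ZMod (2 ^ (j + 1)))) : Matrix (Fin 2) (Fin 2) (ZMod (2 ^ (j + 1)))) 0 1 = 0)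
    (h10 : ((ρ σ : GL (Fin 2) (ZMod (2 ^ (j + 1)))) : Matrix (Fin 2) (Fin 2) (ZMod (2 ^ (j + 1)))) 1 0 = 0) :
    ∃ (m : ℤ), ∃ n ∈ torsionFixing W ((2 ^ (j + 1) : ℕ) : ℤ),
      t' * σ * t'⁻¹ = σ * (t' * t') ^ m * n := by
  haveI : NeZero (2 ^ (j + 1)) := ⟨pow_ne_zero _ two_ne_zero⟩
  obtain ⟨hu0, hu1⟩ := isUnit_diag j (ρ σ) h01 h10
  obtain ⟨u, hu⟩ := hu0
  obtain ⟨v, hv⟩ := hu1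
  obtain ⟨c, hc⟩ := exists_units_sub_eq_two_mul j u v
  set m : ℕ := (-c * ((v⁻¹ : (ZMod (2 ^ (j + 1)))ˣ) : (ZMod (2 ^ (j + 1))))).val with hm
  have hmR : (m : (ZMod (2 ^ (j + 1)))) = -c * ((v⁻¹ : (ZMod (2 ^ (j + 1)))ˣ) : (ZMod (2 ^ (j + 1)))) := by rw [hm, ZMod.natCast_zmod_val]
  have hx : ((ρ σ : GL (Fin 2) (ZMod (2 ^ (j + 1)))) : Matrix (Fin 2) (Fin 2) (ZMod (2 ^ (j + 1)))) 0 0 =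
      ((ρ σ : GL (Fin 2) (ZMod (2 ^ (j + 1)))) : Matrix (Fin 2) (Fin 2) (ZMod (2 ^ (j + 1)))) 1 1 * (2 * (m : (ZMod (2 ^ (j + 1)))) + 1) := by
    rw [← hu, ← hv, hmR]
    have h1 : (v : (ZMod (2 ^ (j + 1)))) * ((v⁻¹ : (ZMod (2 ^ (j + 1)))ˣ) : (ZMod (2 ^ (j + 1)))) = 1 := Units.mul_inv v
    linear_combination -hc + 2 * c * h1
  have key : ρ (t' * σ) = ρ (σ * (t' * t') ^ m * t') := by
    apply Units.ext
    rw [map_mul, map_mul, map_mul, map_pow, map_mul, Units.val_mul, Units.val_mul, Units.val_mul,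
      Units.val_pow_eq_pow_val, Units.val_mul, ht', eq_diag j (ρ σ) h01 h10,
      transvection'_mul_diagonal _ _ (m : (ZMod (2 ^ (j + 1)))) hx, mul_assoc, ← pow_two, ← pow_mul, ← pow_succ,
      transvection'_pow]
    congr 2
    push_cast; ring
  have key' : ρ (t' * σ * t'⁻¹) = ρ (σ * (t' * t') ^ m) := by
    rw [map_mul, key, map_mul, map_inv, mul_inv_cancel_right]
  obtain ⟨n, hn, h⟩ := exists_mem_torsionFixing_of_rep_eq W e ρ hρ key'
  exact ⟨m, n, hn, by rw [zpow_natCast]; exact h⟩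

/-! ##### `LDU`: the stabiliser of `V` is generated by `t², t'²` and the diagonal elements -/

include hρ in
/-- The matrix of a `σ ∈ G_V` is `≡ 1 (mod 2)`: `(α β; γ δ)` with `α · 2^j = 2^j`, `β · 2^j = 0`,
`γ · 2^j = 0`, `δ · 2^j = 2^j`. [cite: LawsonWuthrich2016, §2] -/
private theorem entries_of_mem_fixingSubgroup {σ : absoluteGaloisGroup K}
    (hσ : σ ∈ fixingSubgroup (absoluteGaloisGroup K)
      {v : geomTorsion W ((2 ^ (j + 1) : ℕ) : ℤ) | (2 : ℤ) • v = 0}) :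
    ((ρ σ : GL (Fin 2) (ZMod (2 ^ (j + 1)))) : Matrix (Fin 2) (Fin 2) (ZMod (2 ^ (j + 1)))) 0 0 * ((2 : ZMod (2 ^ (j + 1))) ^ j) = ((2 : ZMod (2 ^ (j + 1))) ^ j) ∧
      ((ρ σ : GL (Fin 2) (ZMod (2 ^ (j + 1)))) : Matrix (Fin 2) (Fin 2) (ZMod (2 ^ (j + 1)))) 0 1 * ((2 : ZMod (2 ^ (j + 1))) ^ j) = 0 ∧
      ((ρ σ : GL (Fin 2) (ZMod (2 ^ (j + 1)))) : Matrix (Fin 2) (Fin 2) (ZMod (2 ^ (j + 1)))) 1 0 * ((2 : ZMod (2 ^ (j + 1))) ^ j) = 0 ∧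
      ((ρ σ : GL (Fin 2) (ZMod (2 ^ (j + 1)))) : Matrix (Fin 2) (Fin 2) (ZMod (2 ^ (j + 1)))) 1 1 * ((2 : ZMod (2 ^ (j + 1))) ^ j) = ((2 : ZMod (2 ^ (j + 1))) ^ j) := by
  have h1 := (mem_fixingSubgroup_iff _).1 hσ (e.symm ![((2 : ZMod (2 ^ (j + 1))) ^ j), 0]) (two_zsmul_E₁ W j e)
  have h2 := (mem_fixingSubgroup_iff _).1 hσ (e.symm ![0, ((2 : ZMod (2 ^ (j + 1))) ^ j)]) (two_zsmul_E₂ W j e)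
  rw [smul_symm_of_rep_eq W j e ρ hρ (Matrix.eta_fin_two _), mulVec_two] at h1 h2
  have h1' := congr_fun (e.symm.injective h1)
  have h2' := congr_fun (e.symm.injective h2)
  have a := h1' 0; have c := h1' 1; have b := h2' 0; have d := h2' 1
  simp only [mul_zero, add_zero, zero_add, Matrix.cons_val_zero, Matrix.cons_val_one,
    Matrix.cons_val_fin_one] at a b c d
  exact ⟨a, b, c, d⟩

include hρ in
/-- **`G_V ⊆ ⟨t², t'², diagonal⟩`** (`LDU` of a matrix `≡ 1 mod 2` with EVEN off-diagonal corrections).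
[cite: LawsonWuthrich2016, §2] -/
private theorem mem_closure_of_mem_fixingSubgroup {t t' : absoluteGaloisGroup K}
    (ht : ((ρ t : GL (Fin 2) (ZMod (2 ^ (j + 1)))) : Matrix (Fin 2) (Fin 2) (ZMod (2 ^ (j + 1)))) = !![1, 1; 0, 1])
    (ht' : ((ρ t' : GL (Fin 2) (ZMod (2 ^ (j + 1)))) : Matrix (Fin 2) (Fin 2) (ZMod (2 ^ (j + 1)))) = !![1, 0; 1, 1])
    {σ : absoluteGaloisGroup K}
    (hσ : σ ∈ fixingSubgroup (absoluteGaloisGroup K)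
      {v : geomTorsion W ((2 ^ (j + 1) : ℕ) : ℤ) | (2 : ℤ) • v = 0}) :
    σ ∈ Subgroup.closure ({t * t, t' * t'} ∪ Set.range (fun δ : {δ : absoluteGaloisGroup K //
      ((ρ δ : GL (Fin 2) (ZMod (2 ^ (j + 1)))) : Matrix (Fin 2) (Fin 2) (ZMod (2 ^ (j + 1)))) 0 1 = 0 ∧
      ((ρ δ : GL (Fin 2) (ZMod (2 ^ (j + 1)))) : Matrix (Fin 2) (Fin 2) (ZMod (2 ^ (j + 1)))) 1 0 = 0} ↦ (δ : absoluteGaloisGroup K))) := by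
  haveI : NeZero (2 ^ (j + 1)) := ⟨pow_ne_zero _ two_ne_zero⟩
  obtain ⟨ha, hb, hc, -⟩ := entries_of_mem_fixingSubgroup W j e ρ hρ hσ
  set A : Matrix (Fin 2) (Fin 2) (ZMod (2 ^ (j + 1))) := ((ρ σ : GL (Fin 2) (ZMod (2 ^ (j + 1)))) : Matrix (Fin 2) (Fin 2) (ZMod (2 ^ (j + 1)))) with hA
  -- `α = 1 + 2a₁` is a unit, `β = 2β'`, `γ = 2γ'`
  obtain ⟨a₁, ha₁⟩ := exists_eq_two_mul_of_mul_half_eq_zero j (A 0 0 - 1)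
    (by rw [sub_mul, one_mul, ha, sub_self])
  have hαu : IsUnit (A 0 0) := by
    rw [show A 0 0 = 1 + 2 * a₁ by rw [← ha₁]; ring]; exact isUnit_one_add_two_mul j a₁
  obtain ⟨u, hu⟩ := hαu
  obtain ⟨β', hβ'⟩ := exists_eq_two_mul_of_mul_half_eq_zero j _ hb
  obtain ⟨γ', hγ'⟩ := exists_eq_two_mul_of_mul_half_eq_zero j _ hc
  -- the exponents
  set na : ℕ := (-(γ' * ((u⁻¹ : (ZMod (2 ^ (j + 1)))ˣ) : (ZMod (2 ^ (j + 1)))))).val with hna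
  set nb : ℕ := (-(((u⁻¹ : (ZMod (2 ^ (j + 1)))ˣ) : (ZMod (2 ^ (j + 1)))) * β')).val with hnb
  have hnaR : (na : (ZMod (2 ^ (j + 1)))) = -(γ' * ((u⁻¹ : (ZMod (2 ^ (j + 1)))ˣ) : (ZMod (2 ^ (j + 1))))) := by rw [hna, ZMod.natCast_zmod_val]
  have hnbR : (nb : (ZMod (2 ^ (j + 1)))) = -(((u⁻¹ : (ZMod (2 ^ (j + 1)))ˣ) : (ZMod (2 ^ (j + 1)))) * β') := by rw [hnb, ZMod.natCast_zmod_val]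
  have h1 : (u : (ZMod (2 ^ (j + 1)))) * ((u⁻¹ : (ZMod (2 ^ (j + 1)))ˣ) : (ZMod (2 ^ (j + 1)))) = 1 := Units.mul_inv u
  have hbrel : A 0 0 * (2 * (nb : (ZMod (2 ^ (j + 1))))) + A 0 1 = 0 := by
    rw [hnbR, hβ', ← hu]; linear_combination (-(2 : (ZMod (2 ^ (j + 1)))) * β') * h1
  have harel : 2 * (na : (ZMod (2 ^ (j + 1)))) * A 0 0 + A 1 0 = 0 := by
    rw [hnaR, hγ', ← hu]; linear_combination (-(2 : (ZMod (2 ^ (j + 1)))) * γ') * h1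
  -- `δ₀ = (t'²)^na σ (t²)^nb` has diagonal matrix
  set δ₀ : absoluteGaloisGroup K := (t' * t') ^ na * σ * (t * t) ^ nb with hδ₀
  have hδ₀mat : ((ρ δ₀ : GL (Fin 2) (ZMod (2 ^ (j + 1)))) : Matrix (Fin 2) (Fin 2) (ZMod (2 ^ (j + 1)))) =
      !![A 0 0, 0; 0, 2 * (na : (ZMod (2 ^ (j + 1)))) * A 0 1 + A 1 1] := by
    rw [hδ₀, map_mul, map_mul, map_pow, map_pow, map_mul, map_mul, Units.val_mul, Units.val_mul,
      Units.val_pow_eq_pow_val, Units.val_pow_eq_pow_val, Units.val_mul, Units.val_mul, ht, ht',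
      ← pow_two, ← pow_two, ← pow_mul, ← pow_mul, transvection_pow, transvection'_pow, ← hA]
    push_cast
    conv_lhs => rw [Matrix.eta_fin_two A]
    rw [lower_mul_mul_upper_eq_diagonal _ _ _ _ _ _ hbrel harel]
  set S : Set (absoluteGaloisGroup K) := ({t * t, t' * t'} ∪ Set.range (fun δ : {δ : absoluteGaloisGroup K //
      ((ρ δ : GL (Fin 2) (ZMod (2 ^ (j + 1)))) : Matrix (Fin 2) (Fin 2) (ZMod (2 ^ (j + 1)))) 0 1 = 0 ∧
      ((ρ δ : GL (Fin 2) (ZMod (2 ^ (j + 1)))) : Matrix (Fin 2) (Fin 2) (ZMod (2 ^ (j + 1)))) 1 0 = 0} ↦ (δ : absoluteGaloisGroup K)))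
    with hSdef
  have hδ₀S : δ₀ ∈ S := by
    refine Set.mem_union_right _ ⟨⟨δ₀, ?_, ?_⟩, rfl⟩
    · rw [hδ₀mat]; simp
    · rw [hδ₀mat]; simp
  have htt : t * t ∈ Subgroup.closure S :=
    Subgroup.subset_closure (Set.mem_union_left _ (Set.mem_insert _ _))
  have ht't' : t' * t' ∈ Subgroup.closure S :=
    Subgroup.subset_closure (Set.mem_union_left _ (Set.mem_insert_of_mem _ (Set.mem_singleton _)))
  have hδ₀' : δ₀ ∈ Subgroup.closure S := Subgroup.subset_closure hδ₀S
  -- `σ = ((t'²)^na)⁻¹ δ₀ ((t²)^nb)⁻¹`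
  have hσ_eq : σ = ((t' * t') ^ na)⁻¹ * δ₀ * ((t * t) ^ nb)⁻¹ := by rw [hδ₀]; group
  rw [hσ_eq]
  exact (Subgroup.closure S).mul_mem ((Subgroup.closure S).mul_mem
    ((Subgroup.closure S).inv_mem ((Subgroup.closure S).pow_mem ht't' na)) hδ₀')
    ((Subgroup.closure S).inv_mem ((Subgroup.closure S).pow_mem htt nb))

/-! ##### Invertible matrices for the special elements -/

omit hρ in
/-- A matrix with a two-sided inverse is the value of an element of `GL₂`. [cite: LawsonWuthrich2016, §2 (G_i ≤ GL₂(ℤ/p^i))] -/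
private theorem exists_gl (A B : Matrix (Fin 2) (Fin 2) (ZMod (2 ^ (j + 1)))) (h1 : A * B = 1) (h2 : B * A = 1) :
    ∃ U : GL (Fin 2) (ZMod (2 ^ (j + 1))), (U : Matrix (Fin 2) (Fin 2) (ZMod (2 ^ (j + 1)))) = A :=
  ⟨⟨A, B, h1, h2⟩, rfl⟩

omit hρ in
/-- The transvection `(1 1; 0 1)` lies in `GL₂(ℤ/2^k)`. [cite: LawsonWuthrich2016, §2 (G_i ≤ GL₂(ℤ/p^i))] -/
private theorem exists_gl_T : ∃ U : GL (Fin 2) (ZMod (2 ^ (j + 1))), (U : Matrix (Fin 2) (Fin 2) (ZMod (2 ^ (j + 1)))) = !![1, 1; 0, 1] :=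
  exists_gl j _ !![1, -1; 0, 1]
    (by ext i k; fin_cases i <;> fin_cases k <;> simp [Matrix.mul_apply, Fin.sum_univ_two])
    (by ext i k; fin_cases i <;> fin_cases k <;> simp [Matrix.mul_apply, Fin.sum_univ_two])

omit hρ in
/-- The transvection `(1 0; 1 1)` lies in `GL₂(ℤ/2^k)`. [cite: LawsonWuthrich2016, §2 (G_i ≤ GL₂(ℤ/p^i))] -/
private theorem exists_gl_T' : ∃ U : GL (Fin 2) (ZMod (2 ^ (j + 1))), (U : Matrix (Fin 2) (Fin 2) (ZMod (2 ^ (j + 1)))) = !![1, 0; 1, 1] :=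
  exists_gl j _ !![1, 0; -1, 1]
    (by ext i k; fin_cases i <;> fin_cases k <;> simp [Matrix.mul_apply, Fin.sum_univ_two])
    (by ext i k; fin_cases i <;> fin_cases k <;> simp [Matrix.mul_apply, Fin.sum_univ_two])

omit hρ in
/-- The swap `(0 1; 1 0)` lies in `GL₂(ℤ/2^k)`. [cite: LawsonWuthrich2016, §2 (G_i ≤ GL₂(ℤ/p^i))] -/
private theorem exists_gl_S : ∃ U : GL (Fin 2) (ZMod (2 ^ (j + 1))), (U : Matrix (Fin 2) (Fin 2) (ZMod (2 ^ (j + 1)))) = !![0, 1; 1, 0] :=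
  exists_gl j _ !![0, 1; 1, 0]
    (by ext i k; fin_cases i <;> fin_cases k <;> simp [Matrix.mul_apply, Fin.sum_univ_two])
    (by ext i k; fin_cases i <;> fin_cases k <;> simp [Matrix.mul_apply, Fin.sum_univ_two])

omit hρ in
/-- The homothety `3` lies in `GL₂(ℤ/2^k)`. [cite: LawsonWuthrich2016, §2 (G_i ≤ GL₂(ℤ/p^i))] -/
private theorem exists_gl_Z : ∃ U : GL (Fin 2) (ZMod (2 ^ (j + 1))), (U : Matrix (Fin 2) (Fin 2) (ZMod (2 ^ (j + 1)))) = !![3, 0; 0, 3] := by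
  obtain ⟨w, hw⟩ := isUnit_one_add_two_mul j (1 : (ZMod (2 ^ (j + 1))))
  have h3 : (w : (ZMod (2 ^ (j + 1)))) = 3 := by rw [hw]; norm_num
  have hinv : (3 : (ZMod (2 ^ (j + 1)))) * ((w⁻¹ : (ZMod (2 ^ (j + 1)))ˣ) : (ZMod (2 ^ (j + 1)))) = 1 := by rw [← h3, Units.mul_inv]
  have hinv' : ((w⁻¹ : (ZMod (2 ^ (j + 1)))ˣ) : (ZMod (2 ^ (j + 1)))) * 3 = 1 := by rw [← h3, Units.inv_mul]
  exact exists_gl j _ !![((w⁻¹ : (ZMod (2 ^ (j + 1)))ˣ) : (ZMod (2 ^ (j + 1)))), 0; 0, ((w⁻¹ : (ZMod (2 ^ (j + 1)))ˣ) : (ZMod (2 ^ (j + 1))))]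
    (by ext i k; fin_cases i <;> fin_cases k <;> simp [Matrix.mul_apply, Fin.sum_univ_two, hinv])
    (by ext i k; fin_cases i <;> fin_cases k <;> simp [Matrix.mul_apply, Fin.sum_univ_two, hinv'])

end Discharge

/-! ##### Assembly -/

section Main

variable {K : Type u} [Field K] (W : WeierstrassCurve K) [W.IsElliptic]

/-- **Any two non-zero classes of `ker (H¹(Γ_K, E[2^k]) → H¹(N, E[2^k]))` coincide** (`k = j + 1 ≥ 1`),
for `E/K` elliptic over any field with `2 ≠ 0`, `ρ̄_{E,2^k}` SURJECTIVE, and any subgroup `N ≤ Γ_K`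
containing `Γ_{K(E[2^k])}` (e.g. `N = Gal(K̄/L)`, `L ⊆ K(E[2^k])`) — the hypotheses of `Rubin1987.eq_zero_or_eq_zero_or_eq_of_mem_subgroupResKer`
discharged in a frame of `E[2^k]`. [cite: LawsonWuthrich2016, Lemma 3, §7.1] [cite: Sah1968, Prop. 2.7 (b)] -/
theorem eq_zero_or_eq_zero_or_eq_of_mem_subgroupResKer_two_pow (j : ℕ) (h2 : (2 : K) ≠ 0)
    (hsurj : W.HasSurjectiveModNGaloisRep ((2 ^ (j + 1) : ℕ) : ℤ))
    (N : Subgroup (absoluteGaloisGroup K)) (hle : torsionFixing W ((2 ^ (j + 1) : ℕ) : ℤ) ≤ N)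
    {κ₁ κ₂ : discreteH1 (absoluteGaloisGroup K) (geomTorsion W ((2 ^ (j + 1) : ℕ) : ℤ))}
    (hκ₁ : κ₁ ∈ subgroupResKer (geomTorsion W ((2 ^ (j + 1) : ℕ) : ℤ)) N)
    (hκ₂ : κ₂ ∈ subgroupResKer (geomTorsion W ((2 ^ (j + 1) : ℕ) : ℤ)) N) :
    κ₁ = 0 ∨ κ₂ = 0 ∨ κ₁ = κ₂ := by
  haveI : Fact (Nat.Prime 2) := ⟨Nat.prime_two⟩
  -- a frame and the framed representation
  obtain ⟨e⟩ := nonempty_addEquiv_geomTorsion W 2 (j + 1) (Nat.succ_pos j) h2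
  obtain ⟨ρ, hρ⟩ := exists_rep_of_addEquiv W e
  -- reduce to `N₀ = Γ_{K(E[2^k])}`
  have hn0 : (((2 ^ (j + 1) : ℕ) : ℤ)) ≠ 0 := by exact_mod_cast pow_ne_zero _ two_ne_zero
  have hN₀ : IsOpen (torsionFixing W ((2 ^ (j + 1) : ℕ) : ℤ) : Set (absoluteGaloisGroup K)) :=
    isOpen_torsionFixing W hn0
  have hNM : ∀ n ∈ torsionFixing W ((2 ^ (j + 1) : ℕ) : ℤ),
      ∀ x : geomTorsion W ((2 ^ (j + 1) : ℕ) : ℤ), n • x = x :=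
    fun n hn x ↦ smul_eq_of_mem_torsionFixing W _ hn x
  have hκ₁' := Rubin1987.subgroupResKer_antitone (M := geomTorsion W ((2 ^ (j + 1) : ℕ) : ℤ)) hle hκ₁
  have hκ₂' := Rubin1987.subgroupResKer_antitone (M := geomTorsion W ((2 ^ (j + 1) : ℕ) : ℤ)) hle hκ₂
  -- the special elements
  obtain ⟨UT, hUT⟩ := exists_gl_T j
  obtain ⟨UT', hUT'⟩ := exists_gl_T' j
  obtain ⟨US, hUS⟩ := exists_gl_S j
  obtain ⟨UZ, hUZ⟩ := exists_gl_Z j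
  obtain ⟨t, ht⟩ := exists_rep_eq_of_hasSurjectiveModNGaloisRep W e ρ hρ hsurj UT
  obtain ⟨t', ht'⟩ := exists_rep_eq_of_hasSurjectiveModNGaloisRep W e ρ hρ hsurj UT'
  obtain ⟨s, hs⟩ := exists_rep_eq_of_hasSurjectiveModNGaloisRep W e ρ hρ hsurj US
  obtain ⟨z, hz⟩ := exists_rep_eq_of_hasSurjectiveModNGaloisRep W e ρ hρ hsurj UZ
  have hT : ((ρ t : GL (Fin 2) (ZMod (2 ^ (j + 1)))) : Matrix (Fin 2) (Fin 2) (ZMod (2 ^ (j + 1)))) =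
      !![1, 1; 0, 1] := by rw [ht, hUT]
  have hT' : ((ρ t' : GL (Fin 2) (ZMod (2 ^ (j + 1)))) : Matrix (Fin 2) (Fin 2) (ZMod (2 ^ (j + 1)))) =
      !![1, 0; 1, 1] := by rw [ht', hUT']
  have hS : ((ρ s : GL (Fin 2) (ZMod (2 ^ (j + 1)))) : Matrix (Fin 2) (Fin 2) (ZMod (2 ^ (j + 1)))) =
      !![0, 1; 1, 0] := by rw [hs, hUS]
  have hZ : ((ρ z : GL (Fin 2) (ZMod (2 ^ (j + 1)))) : Matrix (Fin 2) (Fin 2) (ZMod (2 ^ (j + 1)))) =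
      !![3, 0; 0, 3] := by rw [hz, hUZ]
  -- the abstract criterion
  exact Rubin1987.eq_zero_or_eq_zero_or_eq_of_mem_subgroupResKer hN₀ hNM
    (z_central W j e ρ hρ hZ) (z_smul W j e ρ hρ hZ)
    (two_zsmul_E₁ W j e) (two_zsmul_E₂ W j e) (E₁_ne_zero W j e) (E₂_ne_zero W j e) (E₁_ne_E₂ W j e)
    (mem_V_iff W j e) (halving W j e ρ hρ hT hT') (t_smul_E₁ W j e ρ hρ hT) (t_smul_E₂ W j e ρ hρ hT)
    (t'_smul_E₁ W j e ρ hρ hT') (t'_smul_E₂ W j e ρ hρ hT') (swap_conj W j e ρ hρ hS hT hT')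
    (fun δ : {δ : absoluteGaloisGroup K //
        ((ρ δ : GL (Fin 2) (ZMod (2 ^ (j + 1)))) : Matrix (Fin 2) (Fin 2) (ZMod (2 ^ (j + 1)))) 0 1 = 0 ∧
        ((ρ δ : GL (Fin 2) (ZMod (2 ^ (j + 1)))) : Matrix (Fin 2) (Fin 2) (ZMod (2 ^ (j + 1)))) 1 0 = 0} ↦
      (δ : absoluteGaloisGroup K))
    (fun δ ↦ mem_fixingSubgroup_of_diag W j e ρ hρ δ.2.1 δ.2.2)
    (fun δ ↦ conj_diag_t W j e ρ hρ hT δ.2.1 δ.2.2) (fun δ ↦ conj_diag_t' W j e ρ hρ hT' δ.2.1 δ.2.2)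
    (fun g hg ↦ ⟨g, mem_closure_of_mem_fixingSubgroup W j e ρ hρ hT hT' hg, 1, Subgroup.one_mem _,
      (mul_one g).symm⟩)
    hκ₁' hκ₂'

/-- **`#H¹(Gal(L/K), E(L)[2^k]) ≤ 2`** for every `L ⊆ K(E[2^k])` (`N = Gal(K̄/L)`; any subgroup with
`Γ_{K(E[2^k])} ≤ N`), `k ≥ 1`, when `ρ̄_{E,2^k}` is surjective — the order form of
`H¹(GL₂(ℤ/2^k), (ℤ/2^k)²) ≅ ℤ/2`, the `p = 2` replacement of `H¹(K(E[p^k])/K, E[p^k]) = 0`.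
[cite: LawsonWuthrich2016, Lemma 3, §7.1] -/
theorem natCard_subgroupResKer_two_pow_le_two (j : ℕ) (h2 : (2 : K) ≠ 0)
    (hsurj : W.HasSurjectiveModNGaloisRep ((2 ^ (j + 1) : ℕ) : ℤ))
    (N : Subgroup (absoluteGaloisGroup K)) (hle : torsionFixing W ((2 ^ (j + 1) : ℕ) : ℤ) ≤ N) :
    Nat.card (subgroupResKer (geomTorsion W ((2 ^ (j + 1) : ℕ) : ℤ)) N) ≤ 2 :=
  Rubin1987.natCard_le_two_of_forall_eq_zero_or _ fun _ ha _ hb ↦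
    eq_zero_or_eq_zero_or_eq_of_mem_subgroupResKer_two_pow W j h2 hsurj N hle ha hb

/-- **Pairing currency** (`HeegnerPointsKolyvaginPairing`): two classes `x₁, x₂ ∈ H¹(K, E[2^k])` with
`[xᵢ, ρ] = 0` for all `ρ ∈ Γ_{K(E[2^k])}` satisfy `x₁ = 0 ∨ x₂ = 0 ∨ x₁ = x₂` (surjective `ρ̄_{E,2^k}`,
`2 ≠ 0` in `K`): the `p = 2` form of the injectivity `Rubin1987.eq_zero_of_forall_h1Eval_eq_zero`.
[cite: LawsonWuthrich2016, Lemma 3, §7.1] [cite: GrossLMS1991, §9 (pairing after Prop. 9.1)] -/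
theorem eq_zero_or_eq_zero_or_eq_of_forall_h1Eval_eq_zero (j : ℕ) (h2 : (2 : K) ≠ 0)
    (hsurj : W.HasSurjectiveModNGaloisRep ((2 ^ (j + 1) : ℕ) : ℤ))
    {x₁ x₂ : galH1Torsion W ((2 ^ (j + 1) : ℕ) : ℤ)}
    (hx₁ : ∀ ρ ∈ torsionFixing W ((2 ^ (j + 1) : ℕ) : ℤ), h1Eval W _ x₁ ρ = 0)
    (hx₂ : ∀ ρ ∈ torsionFixing W ((2 ^ (j + 1) : ℕ) : ℤ), h1Eval W _ x₂ ρ = 0) :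
    x₁ = 0 ∨ x₂ = 0 ∨ x₁ = x₂ := by
  have hmem : ∀ {x : galH1Torsion W ((2 ^ (j + 1) : ℕ) : ℤ)},
      (∀ ρ ∈ torsionFixing W ((2 ^ (j + 1) : ℕ) : ℤ), h1Eval W _ x ρ = 0) →
      x ∈ subgroupResKer (geomTorsion W ((2 ^ (j + 1) : ℕ) : ℤ)) (torsionFixing W ((2 ^ (j + 1) : ℕ) : ℤ)) :=
    fun {x} hx ↦ by
    have h := (oneCocycleClass_mem_subgroupResKer_iff _ (reprCocycle W _ x)).2 ⟨0, fun ρ ↦ by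
      rw [smul_zero, sub_zero]
      exact hx ρ ρ.2⟩
    rwa [oneCocycleClass_reprCocycle] at h
  exact eq_zero_or_eq_zero_or_eq_of_mem_subgroupResKer_two_pow W j h2 hsurj
    (torsionFixing W ((2 ^ (j + 1) : ℕ) : ℤ)) le_rfl (hmem hx₁) (hmem hx₂)

end Main

end LawsonWuthrich2016

end Literature.NumberTheory.EllipticCurves

end
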